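import Literature.Probability.LatticeModels.RandomClusterDomainMarkovFree
import Literature.Probability.LatticeModels.RandomClusterIsoInvariance
import HarnessLib

/-!
# Wired and free random-cluster measures on boxes of `ℤ^d` at arbitrary positions:
# monotonicity in the domain, translation and symmetry invariance of edge densities

Topic `Literature/Probability/LatticeModels`. Infrastructure for the infinite-volume limits of the
random-cluster model on `ℤ^d` along boxes (Grimmett 2006, §4.3 and Thm. (4.19)): the tree's
monotonicity of the wired box measures in the box (`rcMeasure_real_box_restrict_le`, concentric
boxes `Λ_m ⊆ Λ_n`) is extended to nested coordinate boxes `∏ [aᵢ, bᵢ] ⊆ ∏ [a'ᵢ, b'ᵢ]` at arbitrary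
positions (`rcMeasure_real_icc_restrict_le`; the environment of the inner box is connected through
the outer one, `icc_envSet_connected`), and combined with the invariance of `rcMeasure` under the
automorphisms of `ℤ^d` (`RandomClusterIsoInvariance.lean`) to prove that the limiting wired and
free **edge densities**

  `h¹_{p,q}(e) = inf_n φ¹_{Λ_n,p,q}(e open)`, `h⁰_{p,q}(e) = sup_n φ⁰_{Λ_n,p,q}(e open)`

(limits along the centred boxes `Λ_n = [-n,n]^d`, which are monotone by Grimmett 2006, Thm. (4.19)
and its proof, (4.24)) do not depend on the edge `e` (Grimmett 2006, (4.61): "since the `φ^b_{p,q}`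
are automorphism-invariant, `h^b(p,q)` does not depend on the choice of `e`"):
`boxWiredEdgeProb_anti`/`boxFreeEdgeProb_mono`, `tendsto_boxWiredEdgeProb`/`tendsto_boxFreeEdgeProb`,
`wiredEdgeDensity_map_add`/`freeEdgeDensity_map_add` (translations, by sandwiching translated boxes
between centred ones), `wiredEdgeDensity_map_signedPerm`/`freeEdgeDensity_map_signedPerm` (signed
coordinate permutations, which preserve every `Λ_n`),
`wiredEdgeDensity_eq_of_mem_edgeSet`/`freeEdgeDensity_eq_of_mem_edgeSet`.

Everything is proved; no named facts.

## References

* G. Grimmett, *The Random-Cluster Model*, Springer 2006: §4.2 (4.11)–(4.12), Lemma (4.13),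
  Thm. (4.19) and its proof (4.24); §4.3 (automorphism invariance); (4.61). [Grimmett2006]
-/

noncomputable section

open MeasureTheory Finset SimpleGraph Filter Topology
open Literature.Probability.Percolation

namespace Literature.Probability.LatticeModels

variable {d : ℕ}

/-! ### Coordinate boxes `Icc a b = ∏ᵢ [aᵢ, bᵢ]` of `ℤ^d` -/

section IccBox

/-- Membership in a coordinate box. [folklore] -/
theorem mem_siteIcc_iff {a b x : Site d} : x ∈ Finset.Icc a b ↔ ∀ i, a i ≤ x i ∧ x i ≤ b i := by
  rw [Finset.mem_Icc, Pi.le_def, Pi.le_def, ← forall_and]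

/-- The centred box `Λ_n` is the coordinate box `[-n, n]^d`. [cite: Grimmett2006, §4.2 (boxes Λ)] -/
theorem box_eq_Icc' (n : ℕ) : box d n = Finset.Icc (fun _ => -(n : ℤ)) (fun _ => (n : ℤ)) := by
  ext x; rw [mem_box, mem_siteIcc_iff]

/-- A vertex of the box whose `i`-th coordinate is maximal lies on the inner boundary.
[cite: Grimmett2006, §4.2 (∂Λ)] -/
theorem mem_innerBoundary_Icc_of_apply_eq_top {a b x : Site d} (hx : x ∈ Finset.Icc a b) (i : Fin d)
    (hi : x i = b i) : x ∈ innerBoundary (zdGraph d) (Finset.Icc a b) := by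
  refine mem_innerBoundary_iff.2 ⟨hx, x + Pi.single i 1, fun hmem => ?_,
    (zdGraph_adj_iff _ _).2 ⟨i, Or.inl rfl⟩⟩
  have := ((mem_siteIcc_iff.1 hmem) i).2
  rw [Pi.add_apply, Pi.single_eq_same] at this
  omega

/-- A vertex of the box whose `i`-th coordinate is minimal lies on the inner boundary.
[cite: Grimmett2006, §4.2 (∂Λ)] -/
theorem mem_innerBoundary_Icc_of_apply_eq_bot {a b x : Site d} (hx : x ∈ Finset.Icc a b) (i : Fin d)
    (hi : x i = a i) : x ∈ innerBoundary (zdGraph d) (Finset.Icc a b) := by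
  refine mem_innerBoundary_iff.2 ⟨hx, x - Pi.single i 1, fun hmem => ?_, zdGraph_adj_sub_single_one x i⟩
  have := ((mem_siteIcc_iff.1 hmem) i).1
  rw [sub_single_eq, Pi.add_apply, Pi.single_eq_same] at this
  omega

/-- A nonempty coordinate box has a nonempty inner boundary (in dimension `d ≥ 1`).
[cite: Grimmett2006, §4.2 (∂Λ)] -/
theorem innerBoundary_Icc_nonempty (hd : 0 < d) {a b : Site d} (hab : a ≤ b) :
    (innerBoundary (zdGraph d) (Finset.Icc a b)).Nonempty :=
  ⟨b, mem_innerBoundary_Icc_of_apply_eq_top (Finset.mem_Icc.2 ⟨hab, le_rfl⟩) ⟨0, hd⟩ rfl⟩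

/-- One step in direction `+eᵢ` inside the box. [folklore] -/
theorem add_single_mem_Icc {a b x : Site d} (hx : x ∈ Finset.Icc a b) {i : Fin d} (hi : x i < b i) :
    x + Pi.single i 1 ∈ Finset.Icc a b := by
  rw [mem_siteIcc_iff] at hx ⊢
  intro j
  by_cases hji : j = i
  · subst hji; rw [Pi.add_apply, Pi.single_eq_same]; have := hx j; omega
  · rw [Pi.add_apply, Pi.single_eq_of_ne hji, add_zero]; exact hx j

/-- One step in direction `-eᵢ` inside the box. [folklore] -/
theorem sub_single_mem_Icc {a b x : Site d} (hx : x ∈ Finset.Icc a b) {i : Fin d} (hi : a i < x i) :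
    x - Pi.single i 1 ∈ Finset.Icc a b := by
  rw [sub_single_eq]
  rw [mem_siteIcc_iff] at hx ⊢
  intro j
  by_cases hji : j = i
  · subst hji; rw [Pi.add_apply, Pi.single_eq_same]; have := hx j; omega
  · rw [Pi.add_apply, Pi.single_eq_of_ne hji, add_zero]; exact hx j

variable {a b a' b' : Site d} (h : Finset.Icc a b ⊆ Finset.Icc a' b')

/-- **Outward escape, increasing coordinate**: in `∏[a'ᵢ,b'ᵢ]`, a vertex with `i`-th coordinate
`> bᵢ` is joined in the environment graph of `∏[aᵢ,bᵢ] ⊆ ∏[a'ᵢ,b'ᵢ]` to the boundary of the outer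
box (move in direction `+eᵢ`). [folklore] -/
theorem icc_envGraph_reachable_boundary_of_lt (i : Fin d) :
    ∀ k : ℕ, ∀ v : ↥(Finset.Icc a' b'), b i < v.1 i → b' i - v.1 i ≤ k →
      ∃ t : ↥(Finset.Icc a' b'), t ∈ wiredBoundary (zdGraph d) (Finset.Icc a' b') ∧
        (envGraph (zdGraph d) h).Reachable v t := by
  intro k
  induction k with
  | zero =>
    intro v _ hk
    have hvn : v.1 i = b' i := le_antisymm ((mem_siteIcc_iff.1 v.2) i).2 (by omega)
    exact ⟨v, mem_innerBoundary_Icc_of_apply_eq_top v.2 i hvn, Reachable.refl _⟩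
  | succ k ih =>
    intro v hvm hk
    by_cases hvn : v.1 i = b' i
    · exact ⟨v, mem_innerBoundary_Icc_of_apply_eq_top v.2 i hvn, Reachable.refl _⟩
    · have hlt : v.1 i < b' i := lt_of_le_of_ne ((mem_siteIcc_iff.1 v.2) i).2 hvn
      have hw : v.1 + Pi.single i 1 ∈ Finset.Icc a' b' := add_single_mem_Icc v.2 hlt
      have hwi : (v.1 + Pi.single i 1 : Site d) i = v.1 i + 1 := by rw [Pi.add_apply, Pi.single_eq_same]
      have hwm : v.1 + Pi.single i 1 ∉ Finset.Icc a b := by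
        intro hmem
        have := ((mem_siteIcc_iff.1 hmem) i).2
        rw [hwi] at this
        omega
      obtain ⟨t, ht, hwt⟩ := ih ⟨v.1 + Pi.single i 1, hw⟩ (by dsimp only; rw [hwi]; omega)
        (by dsimp only; rw [hwi]; omega)
      exact ⟨t, ht, (Adj.reachable (envGraph_adj_of_adj_of_notMem h
        (v := ⟨v.1 + Pi.single i 1, hw⟩) ((zdGraph_adj_iff _ _).2 ⟨i, Or.inl rfl⟩) hwm)).trans hwt⟩

/-- **Outward escape, decreasing coordinate**: a vertex with `i`-th coordinate `< aᵢ` is joined in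
the environment graph to the boundary of the outer box (move in direction `-eᵢ`). [folklore] -/
theorem icc_envGraph_reachable_boundary_of_lt_neg (i : Fin d) :
    ∀ k : ℕ, ∀ v : ↥(Finset.Icc a' b'), v.1 i < a i → v.1 i - a' i ≤ k →
      ∃ t : ↥(Finset.Icc a' b'), t ∈ wiredBoundary (zdGraph d) (Finset.Icc a' b') ∧
        (envGraph (zdGraph d) h).Reachable v t := by
  intro k
  induction k with
  | zero =>
    intro v _ hk
    have hvn : v.1 i = a' i := le_antisymm (by omega) ((mem_siteIcc_iff.1 v.2) i).1
    exact ⟨v, mem_innerBoundary_Icc_of_apply_eq_bot v.2 i hvn, Reachable.refl _⟩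
  | succ k ih =>
    intro v hvm hk
    by_cases hvn : v.1 i = a' i
    · exact ⟨v, mem_innerBoundary_Icc_of_apply_eq_bot v.2 i hvn, Reachable.refl _⟩
    · have hlt : a' i < v.1 i := lt_of_le_of_ne ((mem_siteIcc_iff.1 v.2) i).1 (Ne.symm hvn)
      have hw : v.1 - Pi.single i 1 ∈ Finset.Icc a' b' := sub_single_mem_Icc v.2 hlt
      have hwi : (v.1 - Pi.single i 1 : Site d) i = v.1 i - 1 := by
        rw [sub_single_eq, Pi.add_apply, Pi.single_eq_same]; ring
      have hwm : v.1 - Pi.single i 1 ∉ Finset.Icc a b := by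
        intro hmem
        have := ((mem_siteIcc_iff.1 hmem) i).1
        rw [hwi] at this
        omega
      obtain ⟨t, ht, hwt⟩ := ih ⟨v.1 - Pi.single i 1, hw⟩ (by dsimp only; rw [hwi]; omega)
        (by dsimp only; rw [hwi]; omega)
      exact ⟨t, ht, (Adj.reachable (envGraph_adj_of_adj_of_notMem h
        (v := ⟨v.1 - Pi.single i 1, hw⟩) (zdGraph_adj_sub_single_one v.1 i) hwm)).trans hwt⟩

/-- Every vertex of the outer box outside the inner box is joined in the environment graph to the
boundary of the outer box. [folklore] -/
theorem icc_envGraph_reachable_boundary_of_notMem (v : ↥(Finset.Icc a' b')) (hv : v.1 ∉ Finset.Icc a b) :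
    ∃ t : ↥(Finset.Icc a' b'), t ∈ wiredBoundary (zdGraph d) (Finset.Icc a' b') ∧
      (envGraph (zdGraph d) h).Reachable v t := by
  rw [mem_siteIcc_iff, not_forall] at hv
  obtain ⟨i, hi⟩ := hv
  rcases not_and_or.1 hi with hi | hi
  · exact icc_envGraph_reachable_boundary_of_lt_neg h i (v.1 i - a' i).toNat v (by omega)
      (Int.self_le_toNat _)
  · exact icc_envGraph_reachable_boundary_of_lt h i (b' i - v.1 i).toNat v (by omega)
      (Int.self_le_toNat _)

/-- Every environment vertex (outside the inner box, or on its inner boundary) is joined in the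
environment graph to the boundary of the outer box. [folklore] -/
theorem icc_envGraph_reachable_boundary_of_mem_envSet (v : ↥(Finset.Icc a' b'))
    (hv : v ∈ envSet (zdGraph d) (Finset.Icc a b) (Finset.Icc a' b')) :
    ∃ t : ↥(Finset.Icc a' b'), t ∈ wiredBoundary (zdGraph d) (Finset.Icc a' b') ∧
      (envGraph (zdGraph d) h).Reachable v t := by
  by_cases hvm : v.1 ∈ Finset.Icc a b
  · have hvb : v.1 ∈ innerBoundary (zdGraph d) (Finset.Icc a b) := hv.resolve_left (fun hn => hn hvm)
    obtain ⟨_, y, hy, hvy⟩ := mem_innerBoundary_iff.1 hvb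
    by_cases hyn : y ∈ Finset.Icc a' b'
    · set w : ↥(Finset.Icc a' b') := ⟨y, hyn⟩
      obtain ⟨t, ht, hwt⟩ := icc_envGraph_reachable_boundary_of_notMem h w hy
      exact ⟨t, ht, (Adj.reachable (envGraph_adj_of_adj_of_notMem h (v := w) hvy hy)).trans hwt⟩
    · exact ⟨v, mem_innerBoundary_iff.2 ⟨v.2, y, hyn, hvy⟩, Reachable.refl _⟩
  · exact icc_envGraph_reachable_boundary_of_notMem h v hvm

/-- **The environment of nested coordinate boxes is connected.** [folklore] -/
theorem icc_envSet_connected :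
    ∀ u ∈ envSet (zdGraph d) (Finset.Icc a b) (Finset.Icc a' b'),
      ∀ v ∈ envSet (zdGraph d) (Finset.Icc a b) (Finset.Icc a' b'),
        (envGraph (zdGraph d) h).Reachable u v := by
  intro u hu v hv
  obtain ⟨tu, htu, hutu⟩ := icc_envGraph_reachable_boundary_of_mem_envSet h u hu
  obtain ⟨tv, htv, hvtv⟩ := icc_envGraph_reachable_boundary_of_mem_envSet h v hv
  exact hutu.trans ((envGraph_reachable_of_mem_wiredBoundary _ htu htv).trans hvtv.symm)

/-- **Monotonicity of the wired measures in the domain for nested coordinate boxes at arbitrary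
positions** (Grimmett 2006, proof of Thm. (4.19)(a), (4.24) reversed): for coordinate boxes
`Λ = ∏[aᵢ,bᵢ] ⊆ Δ = ∏[a'ᵢ,b'ᵢ]` of `ℤ^d` (`d ≥ 1`, `a ≤ b`), `0 ≤ p ≤ 1`, `q ≥ 1` and an increasing
event `B` of `E_Λ`: `φ¹_{Δ,p,q}(B) ≤ φ¹_{Λ,p,q}(B)`. [cite: Grimmett2006, Thm. (4.19)(a), proof, eq. (4.24)] -/
theorem rcMeasure_real_icc_restrict_le (hd : 0 < d) (hab : a ≤ b) {p q : ℝ} (hp : p ∈ Set.Icc (0 : ℝ) 1)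
    (hq : 1 ≤ q) {B : Set (Percolation.BondConfig ↥(Finset.Icc a b))} (hB : IsUpperSet B) :
    (rcMeasure (finsetGraph (zdGraph d) (Finset.Icc a' b')) p q
        (wiredBoundary (zdGraph d) (Finset.Icc a' b'))).real (finsetRestrict h ⁻¹' B) ≤
      (rcMeasure (finsetGraph (zdGraph d) (Finset.Icc a b)) p q
        (wiredBoundary (zdGraph d) (Finset.Icc a b))).real B :=
  rcMeasure_real_restrict_le h hp hq (icc_envSet_connected h) (fun _ => innerBoundary_Icc_nonempty hd hab) hB

end IccBox

/-! ### The event "the edge `e` of `ℤ^d` is open" on configurations of a finite piece -/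

section EdgeEvent

/-- For a finite piece `S` of `ℤ^d` and an unordered pair `e` of lattice points, the event
"`e` is an open edge of the configuration of `S`" (`J_e` of Grimmett 2006, (4.61), read on the
configurations of `S`; empty unless both endpoints of `e` lie in `S`). [cite: Grimmett2006, (4.61) (J_e)] -/
def eOpen (S : Finset (Site d)) (e : Sym2 (Site d)) : Set (Percolation.BondConfig ↥S) :=
  {ω | ∃ e' ∈ ω, Sym2.map Subtype.val e' = e}

/-- Membership in `eOpen`. [cite: Grimmett2006, (4.61)] -/
theorem mem_eOpen_iff {S : Finset (Site d)} {e : Sym2 (Site d)} {ω : Percolation.BondConfig ↥S} :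
    ω ∈ eOpen S e ↔ ∃ e' ∈ ω, Sym2.map Subtype.val e' = e := Iff.rfl

/-- `eOpen S e` is increasing. [cite: Grimmett2006, (4.61)] -/
theorem isUpperSet_eOpen (S : Finset (Site d)) (e : Sym2 (Site d)) : IsUpperSet (eOpen S e) := by
  rintro ω ω' hle ⟨e', he', rfl⟩
  exact ⟨e', hle he', rfl⟩

/-- With both endpoints in `S`, `eOpen S s(x,y)` is the event that the edge `⟨x,y⟩` of `S` is open.
[cite: Grimmett2006, (4.61)] -/
theorem mem_eOpen_mk_iff {S : Finset (Site d)} {x y : Site d} (hx : x ∈ S) (hy : y ∈ S)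
    (ω : Percolation.BondConfig ↥S) : ω ∈ eOpen S s(x, y) ↔ s(⟨x, hx⟩, ⟨y, hy⟩) ∈ ω := by
  constructor
  · rintro ⟨e', he', heq⟩
    induction e' using Sym2.ind with
    | h u v =>
      rw [Sym2.map_mk, Sym2.eq_iff] at heq
      rcases heq with ⟨hu, hv⟩ | ⟨hu, hv⟩
      · have h1 : u = ⟨x, hx⟩ := Subtype.ext hu
        have h2 : v = ⟨y, hy⟩ := Subtype.ext hv
        rwa [h1, h2] at he'
      · have h1 : u = ⟨y, hy⟩ := Subtype.ext hu
        have h2 : v = ⟨x, hx⟩ := Subtype.ext hv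
        rw [h1, h2] at he'
        rwa [Sym2.eq_swap]
  · intro h
    exact ⟨_, h, by rw [Sym2.map_mk]⟩

/-- Restriction to a sub-piece does not change the event, provided both endpoints lie in the
sub-piece: `ρ⁻¹(eOpen Λ e) = eOpen Δ e` for `Λ ⊆ Δ`. [cite: Grimmett2006, §4.2 (configurations on E_Λ)] -/
theorem finsetRestrict_preimage_eOpen {Λ Δ : Finset (Site d)} (h : Λ ⊆ Δ) {e : Sym2 (Site d)}
    (he : ∀ z ∈ e, z ∈ Λ) : finsetRestrict h ⁻¹' eOpen Λ e = eOpen Δ e := by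
  induction e using Sym2.ind with
  | h x y =>
    have hx : x ∈ Λ := he x (Sym2.mem_mk_left x y)
    have hy : y ∈ Λ := he y (Sym2.mem_mk_right x y)
    ext ω
    rw [Set.mem_preimage, mem_eOpen_mk_iff hx hy, mem_eOpen_mk_iff (h hx) (h hy),
      mem_finsetRestrict_iff, edgeLift_mk]
    rfl

/-- Transport of the event under an automorphism `g` of `ℤ^d` restricted to finite pieces
`S → S' = g(S)`: the preimage of `eOpen S' (g e)` is `eOpen S e`. [cite: Grimmett2006, §4.3 (automorphism invariance)] -/
theorem relabel_preimage_eOpen (g : zdGraph d ≃g zdGraph d) {S S' : Finset (Site d)}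
    (hS : ∀ x, x ∈ S' ↔ g.symm x ∈ S) (e : Sym2 (Site d)) :
    BondConfig.relabel (sym2Equiv (finsetGraphIso g hS).toEquiv) ⁻¹' eOpen S' (e.map g) = eOpen S e := by
  ext ω
  simp only [Set.mem_preimage, mem_eOpen_iff, BondConfig.relabel_apply, Set.mem_image]
  constructor
  · rintro ⟨f', ⟨f, hf, rfl⟩, heq⟩
    refine ⟨f, hf, ?_⟩
    induction f using Sym2.ind with
    | h u v =>
      rw [sym2Equiv_apply, Sym2.map_mk, Sym2.map_mk] at heq
      rw [Sym2.map_mk]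
      have : Sym2.map g s(u.1, v.1) = Sym2.map g e := by
        rw [Sym2.map_mk]; exact heq
      exact Sym2.map.injective g.injective this
  · rintro ⟨f, hf, rfl⟩
    refine ⟨sym2Equiv (finsetGraphIso g hS).toEquiv f, ⟨f, hf, rfl⟩, ?_⟩
    induction f using Sym2.ind with
    | h u v => rw [sym2Equiv_apply, Sym2.map_mk, Sym2.map_mk, Sym2.map_mk]; rfl

/-- The wired measure of a finite piece `S` of `ℤ^d` (boundary `∂S` wired) on the event `eOpen S e`.
[cite: Grimmett2006, §4.2 (4.11)–(4.12) with ξ = 1, and (4.61)] -/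
def wiredEdgeProb (S : Finset (Site d)) (p q : ℝ) (e : Sym2 (Site d)) : ℝ :=
  (rcMeasure (finsetGraph (zdGraph d) S) p q (wiredBoundary (zdGraph d) S)).real (eOpen S e)

/-- The free measure of a finite piece `S` of `ℤ^d` on the event `eOpen S e`.
[cite: Grimmett2006, §4.2 (4.11)–(4.12) with ξ = 0, and (4.61)] -/
def freeEdgeProb (S : Finset (Site d)) (p q : ℝ) (e : Sym2 (Site d)) : ℝ :=
  (rcMeasure (finsetGraph (zdGraph d) S) p q ∅).real (eOpen S e)

/-- **Automorphism invariance of the wired edge densities**: `φ¹_S(e open) = φ¹_{g S}(g e open)`.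
[cite: Grimmett2006, §4.3 (automorphism invariance)] -/
theorem wiredEdgeProb_eq_of_iso (g : zdGraph d ≃g zdGraph d) {S S' : Finset (Site d)}
    (hS : ∀ x, x ∈ S' ↔ g.symm x ∈ S) {p q : ℝ} (hp : p ∈ Set.Icc (0 : ℝ) 1) (hq : 0 < q)
    (e : Sym2 (Site d)) : wiredEdgeProb S p q e = wiredEdgeProb S' p q (e.map g) := by
  rw [wiredEdgeProb, wiredEdgeProb, ← relabel_preimage_eOpen g hS e,
    rcMeasure_real_preimage_relabel (finsetGraphIso g hS) hp hq, image_finsetGraphIso_wiredBoundary]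

/-- **Automorphism invariance of the free edge densities**: `φ⁰_S(e open) = φ⁰_{g S}(g e open)`.
[cite: Grimmett2006, §4.3 (automorphism invariance)] -/
theorem freeEdgeProb_eq_of_iso (g : zdGraph d ≃g zdGraph d) {S S' : Finset (Site d)}
    (hS : ∀ x, x ∈ S' ↔ g.symm x ∈ S) {p q : ℝ} (hp : p ∈ Set.Icc (0 : ℝ) 1) (hq : 0 < q)
    (e : Sym2 (Site d)) : freeEdgeProb S p q e = freeEdgeProb S' p q (e.map g) := by
  rw [freeEdgeProb, freeEdgeProb, ← relabel_preimage_eOpen g hS e,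
    rcMeasure_real_preimage_relabel (finsetGraphIso g hS) hp hq, Set.image_empty]

/-- Wired monotonicity for nested coordinate boxes, on the edge events: for `Λ = ∏[aᵢ,bᵢ] ⊆
Δ = ∏[a'ᵢ,b'ᵢ]` and `e` with both endpoints in `Λ`, `φ¹_Δ(e open) ≤ φ¹_Λ(e open)`.
[cite: Grimmett2006, Thm. (4.19)(a), proof, eq. (4.24)] -/
theorem wiredEdgeProb_icc_anti (hd : 0 < d) {a b a' b' : Site d} (hab : a ≤ b)
    (h : Finset.Icc a b ⊆ Finset.Icc a' b') {p q : ℝ} (hp : p ∈ Set.Icc (0 : ℝ) 1) (hq : 1 ≤ q)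
    {e : Sym2 (Site d)} (he : ∀ z ∈ e, z ∈ Finset.Icc a b) :
    wiredEdgeProb (Finset.Icc a' b') p q e ≤ wiredEdgeProb (Finset.Icc a b) p q e := by
  rw [wiredEdgeProb, wiredEdgeProb, ← finsetRestrict_preimage_eOpen h he]
  exact rcMeasure_real_icc_restrict_le h hd hab hp hq (isUpperSet_eOpen _ e)

/-- Free monotonicity for nested finite pieces, on the edge events: for `Λ ⊆ Δ` and `e` with both
endpoints in `Λ`, `φ⁰_Λ(e open) ≤ φ⁰_Δ(e open)`. [cite: Grimmett2006, Thm. (4.19)(a), proof, eq. (4.24)] -/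
theorem freeEdgeProb_mono {Λ Δ : Finset (Site d)} (h : Λ ⊆ Δ) {p q : ℝ} (hp : p ∈ Set.Icc (0 : ℝ) 1)
    (hq : 1 ≤ q) {e : Sym2 (Site d)} (he : ∀ z ∈ e, z ∈ Λ) :
    freeEdgeProb Λ p q e ≤ freeEdgeProb Δ p q e := by
  rw [freeEdgeProb, freeEdgeProb, ← finsetRestrict_preimage_eOpen h he]
  exact rcMeasure_real_free_le_restrict h hp hq (isUpperSet_eOpen _ e)

/-- Densities are probabilities: nonnegative. [cite: Grimmett2006, §4.2] -/
theorem wiredEdgeProb_nonneg (S : Finset (Site d)) (p q : ℝ) (e : Sym2 (Site d)) : 0 ≤ wiredEdgeProb S p q e :=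
  measureReal_nonneg

/-- Densities are probabilities: at most one. [cite: Grimmett2006, §4.2] -/
theorem wiredEdgeProb_le_one (S : Finset (Site d)) {p q : ℝ} (hp : p ∈ Set.Icc (0 : ℝ) 1) (hq : 0 < q)
    (e : Sym2 (Site d)) : wiredEdgeProb S p q e ≤ 1 := by
  haveI := isProbabilityMeasure_rcMeasure (finsetGraph (zdGraph d) S) hp hq (wiredBoundary (zdGraph d) S)
  exact measureReal_le_one

/-- Densities are probabilities: nonnegative. [cite: Grimmett2006, §4.2] -/
theorem freeEdgeProb_nonneg (S : Finset (Site d)) (p q : ℝ) (e : Sym2 (Site d)) : 0 ≤ freeEdgeProb S p q e :=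
  measureReal_nonneg

/-- Densities are probabilities: at most one. [cite: Grimmett2006, §4.2] -/
theorem freeEdgeProb_le_one (S : Finset (Site d)) {p q : ℝ} (hp : p ∈ Set.Icc (0 : ℝ) 1) (hq : 0 < q)
    (e : Sym2 (Site d)) : freeEdgeProb S p q e ≤ 1 := by
  haveI := isProbabilityMeasure_rcMeasure (finsetGraph (zdGraph d) S) hp hq (∅ : Set ↥S)
  exact measureReal_le_one

end EdgeEvent

/-! ### Sup-norm radii; centred boxes; translated boxes -/

section Radius

/-- The sup-norm `‖x‖_∞` of a lattice point, as a natural number. [folklore] -/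
def siteRad (x : Site d) : ℕ := Finset.univ.sup fun i => (x i).natAbs

/-- `x ∈ Λ_n ↔ ‖x‖_∞ ≤ n`. [cite: Grimmett2006, §4.2 (boxes Λ_n)] -/
theorem mem_box_iff_siteRad_le {x : Site d} {n : ℕ} : x ∈ box d n ↔ siteRad x ≤ n := by
  rw [mem_box, siteRad, Finset.sup_le_iff]
  simp only [Finset.mem_univ, forall_const]
  refine forall_congr' fun i => ?_
  omega

/-- The radius of an unordered pair: the larger sup-norm of its two points. [folklore] -/
def pairRad (e : Sym2 (Site d)) : ℕ :=
  Sym2.lift ⟨fun x y => max (siteRad x) (siteRad y), fun _ _ => max_comm _ _⟩ e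

/-- `pairRad s(x,y) = max ‖x‖_∞ ‖y‖_∞`. [folklore] -/
@[simp] theorem pairRad_mk (x y : Site d) : pairRad s(x, y) = max (siteRad x) (siteRad y) := rfl

/-- Both points of a pair of radius `≤ n` lie in `Λ_n`. [folklore] -/
theorem mem_box_of_pairRad_le {e : Sym2 (Site d)} {n : ℕ} (hn : pairRad e ≤ n) : ∀ z ∈ e, z ∈ box d n := by
  induction e using Sym2.ind with
  | h x y =>
    intro z hz
    rw [pairRad_mk, max_le_iff] at hn
    rcases Sym2.mem_iff.1 hz with rfl | rfl
    · exact mem_box_iff_siteRad_le.2 hn.1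
    · exact mem_box_iff_siteRad_le.2 hn.2

/-- The sup-norm is subadditive. [folklore] -/
theorem siteRad_add_le (x v : Site d) : siteRad (x + v) ≤ siteRad x + siteRad v := by
  rw [siteRad, Finset.sup_le_iff]
  intro i _
  rw [Pi.add_apply]
  have h1 : (x i).natAbs ≤ siteRad x := Finset.le_sup (f := fun i => (x i).natAbs) (Finset.mem_univ i)
  have h2 : (v i).natAbs ≤ siteRad v := Finset.le_sup (f := fun i => (v i).natAbs) (Finset.mem_univ i)
  have := Int.natAbs_add_le (x i) (v i)
  omega

/-- `‖-v‖_∞ = ‖v‖_∞`. [folklore] -/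
@[simp] theorem siteRad_neg (v : Site d) : siteRad (-v) = siteRad v := by
  simp only [siteRad, Pi.neg_apply, Int.natAbs_neg]

/-- Radius of a translated pair. [folklore] -/
theorem pairRad_map_add_le (e : Sym2 (Site d)) (v : Site d) : pairRad (e.map (· + v)) ≤ pairRad e + siteRad v := by
  induction e using Sym2.ind with
  | h x y =>
    rw [Sym2.map_mk, pairRad_mk, pairRad_mk]
    have := siteRad_add_le x v
    have := siteRad_add_le y v
    omega

/-- Radius of a pair in terms of a translate. [folklore] -/
theorem pairRad_le_pairRad_map_add (e : Sym2 (Site d)) (v : Site d) : pairRad e ≤ pairRad (e.map (· + v)) + siteRad v := by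
  have h := pairRad_map_add_le (e.map (· + v)) (-v)
  rw [Sym2.map_map, siteRad_neg] at h
  have : ((fun x : Site d => x + -v) ∘ fun x => x + v) = id := by
    funext x; simp
  rwa [this, Sym2.map_id] at h

/-- The translate `Λ_n + v` of a centred box is the coordinate box `∏[-n + vᵢ, n + vᵢ]`, and it is
the image of `Λ_n` under the translation automorphism: membership test for `finsetGraphIso`.
[folklore] -/
theorem mem_icc_shift_iff (n : ℕ) (v x : Site d) :
    x ∈ Finset.Icc (fun i => -(n : ℤ) + v i) (fun i => (n : ℤ) + v i) ↔ (zdShiftIso v).symm x ∈ box d n := by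
  rw [show (zdShiftIso v).symm x = x - v from Site.shift_symm_apply v x, mem_siteIcc_iff, mem_box]
  refine forall_congr' fun i => ?_
  rw [Pi.sub_apply]
  omega

/-- `Λ_{n-‖v‖} ⊆ Λ_n + v` for `‖v‖ ≤ n`. [folklore] -/
theorem box_sub_subset_icc_shift {n : ℕ} {v : Site d} (hv : siteRad v ≤ n) :
    box d (n - siteRad v) ⊆ Finset.Icc (fun i => -(n : ℤ) + v i) (fun i => (n : ℤ) + v i) := by
  intro x hx
  rw [mem_box, Nat.cast_sub hv] at hx
  rw [mem_siteIcc_iff]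
  intro i
  have h2 : (v i).natAbs ≤ siteRad v := Finset.le_sup (f := fun i => (v i).natAbs) (Finset.mem_univ i)
  have := hx i
  omega

/-- `Λ_n + v ⊆ Λ_{n+‖v‖}`. [folklore] -/
theorem icc_shift_subset_box_add (n : ℕ) (v : Site d) :
    Finset.Icc (fun i => -(n : ℤ) + v i) (fun i => (n : ℤ) + v i) ⊆ box d (n + siteRad v) := by
  intro x hx
  rw [mem_siteIcc_iff] at hx
  rw [mem_box]
  intro i
  have h2 : (v i).natAbs ≤ siteRad v := Finset.le_sup (f := fun i => (v i).natAbs) (Finset.mem_univ i)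
  have := hx i
  push_cast
  omega

end Radius

/-! ### Edge densities along the centred boxes and their limits -/

section Densities

variable (d)

/-- `φ¹_{Λ_N,p,q}(e open)`: the wired edge density of `e` in the centred box `Λ_N`.
[cite: Grimmett2006, (4.61) and Thm. (4.19)] -/
def boxWiredEdgeProb (p q : ℝ) (e : Sym2 (Site d)) (N : ℕ) : ℝ := wiredEdgeProb (box d N) p q e

/-- `φ⁰_{Λ_N,p,q}(e open)`: the free edge density of `e` in the centred box `Λ_N`.
[cite: Grimmett2006, (4.61) and Thm. (4.19)] -/
def boxFreeEdgeProb (p q : ℝ) (e : Sym2 (Site d)) (N : ℕ) : ℝ := freeEdgeProb (box d N) p q e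

/-- The limiting wired edge density `h¹_{p,q}(e) = inf_N φ¹_{Λ_N,p,q}(e open)` (the infimum over the
boxes containing `e`; it is the limit, `tendsto_boxWiredEdgeProb`). [cite: Grimmett2006, (4.61) with Thm. (4.19)(a)] -/
def wiredEdgeDensity (p q : ℝ) (e : Sym2 (Site d)) : ℝ := ⨅ n : ℕ, boxWiredEdgeProb d p q e (pairRad e + n)

/-- The limiting free edge density `h⁰_{p,q}(e) = sup_N φ⁰_{Λ_N,p,q}(e open)` (the supremum over
the boxes containing `e`; it is the limit, `tendsto_boxFreeEdgeProb`). [cite: Grimmett2006, (4.61) with Thm. (4.19)(a)] -/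
def freeEdgeDensity (p q : ℝ) (e : Sym2 (Site d)) : ℝ := ⨆ n : ℕ, boxFreeEdgeProb d p q e (pairRad e + n)

variable {d}

/-- The wired box densities decrease in the box (from the first box containing `e` on).
[cite: Grimmett2006, Thm. (4.19)(a), proof, eq. (4.24)] -/
theorem boxWiredEdgeProb_anti (hd : 0 < d) {p q : ℝ} (hp : p ∈ Set.Icc (0 : ℝ) 1) (hq : 1 ≤ q)
    {e : Sym2 (Site d)} {N N' : ℕ} (hN : pairRad e ≤ N) (hNN' : N ≤ N') :
    boxWiredEdgeProb d p q e N' ≤ boxWiredEdgeProb d p q e N := by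
  rw [boxWiredEdgeProb, boxWiredEdgeProb, box_eq_Icc', box_eq_Icc']
  refine wiredEdgeProb_icc_anti hd (fun _ => by simp) ?_ hp hq ?_
  · rw [← box_eq_Icc', ← box_eq_Icc']; exact box_mono d hNN'
  · rw [← box_eq_Icc']; exact mem_box_of_pairRad_le hN

/-- The free box densities increase in the box (from the first box containing `e` on).
[cite: Grimmett2006, Thm. (4.19)(a), proof, eq. (4.24)] -/
theorem boxFreeEdgeProb_mono {p q : ℝ} (hp : p ∈ Set.Icc (0 : ℝ) 1) (hq : 1 ≤ q)
    {e : Sym2 (Site d)} {N N' : ℕ} (hN : pairRad e ≤ N) (hNN' : N ≤ N') :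
    boxFreeEdgeProb d p q e N ≤ boxFreeEdgeProb d p q e N' :=
  freeEdgeProb_mono (box_mono d hNN') hp hq (mem_box_of_pairRad_le hN)

/-- `h¹(e) ≤ φ¹_{Λ_N}(e open)` for every box containing `e`. [cite: Grimmett2006, Thm. (4.19)(a)] -/
theorem wiredEdgeDensity_le_boxWiredEdgeProb {p q : ℝ} {e : Sym2 (Site d)} {N : ℕ} (hN : pairRad e ≤ N) :
    wiredEdgeDensity d p q e ≤ boxWiredEdgeProb d p q e N := by
  have h := ciInf_le (f := fun n : ℕ => boxWiredEdgeProb d p q e (pairRad e + n))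
    ⟨0, by rintro _ ⟨n, rfl⟩; exact wiredEdgeProb_nonneg _ _ _ _⟩ (N - pairRad e)
  rwa [Nat.add_sub_cancel' hN] at h

/-- `φ⁰_{Λ_N}(e open) ≤ h⁰(e)` for every box containing `e`. [cite: Grimmett2006, Thm. (4.19)(a)] -/
theorem boxFreeEdgeProb_le_freeEdgeDensity {p q : ℝ} (hp : p ∈ Set.Icc (0 : ℝ) 1) (hq : 0 < q) {e : Sym2 (Site d)} {N : ℕ}
    (hN : pairRad e ≤ N) : boxFreeEdgeProb d p q e N ≤ freeEdgeDensity d p q e := by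
  have h := le_ciSup (f := fun n : ℕ => boxFreeEdgeProb d p q e (pairRad e + n))
    ⟨1, by rintro _ ⟨n, rfl⟩; exact freeEdgeProb_le_one _ hp hq _⟩ (N - pairRad e)
  rwa [Nat.add_sub_cancel' hN] at h

/-- **`φ¹_{Λ_N}(e open) → h¹(e)`** as `N → ∞` (monotone convergence). [cite: Grimmett2006, Thm. (4.19)(a)] -/
theorem tendsto_boxWiredEdgeProb (hd : 0 < d) {p q : ℝ} (hp : p ∈ Set.Icc (0 : ℝ) 1) (hq : 1 ≤ q)
    (e : Sym2 (Site d)) : Tendsto (fun N => boxWiredEdgeProb d p q e N) atTop (𝓝 (wiredEdgeDensity d p q e)) := by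
  have hanti : Antitone fun n : ℕ => boxWiredEdgeProb d p q e (pairRad e + n) :=
    fun n m hnm => boxWiredEdgeProb_anti hd hp hq (Nat.le_add_right _ _) (Nat.add_le_add_left hnm _)
  have h := tendsto_atTop_ciInf hanti ⟨0, by rintro _ ⟨n, rfl⟩; exact wiredEdgeProb_nonneg _ _ _ _⟩
  unfold wiredEdgeDensity
  rw [← tendsto_add_atTop_iff_nat (pairRad e)]
  simpa only [add_comm _ (pairRad e)] using h

/-- **`φ⁰_{Λ_N}(e open) → h⁰(e)`** as `N → ∞` (monotone convergence). [cite: Grimmett2006, Thm. (4.19)(a)] -/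
theorem tendsto_boxFreeEdgeProb {p q : ℝ} (hp : p ∈ Set.Icc (0 : ℝ) 1) (hq : 1 ≤ q)
    (e : Sym2 (Site d)) : Tendsto (fun N => boxFreeEdgeProb d p q e N) atTop (𝓝 (freeEdgeDensity d p q e)) := by
  have hq0 : 0 < q := one_pos.trans_le hq
  have hmono : Monotone fun n : ℕ => boxFreeEdgeProb d p q e (pairRad e + n) :=
    fun n m hnm => boxFreeEdgeProb_mono hp hq (Nat.le_add_right _ _) (Nat.add_le_add_left hnm _)
  have h := tendsto_atTop_ciSup hmono ⟨1, by rintro _ ⟨n, rfl⟩; exact freeEdgeProb_le_one _ hp hq0 _⟩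
  unfold freeEdgeDensity
  rw [← tendsto_add_atTop_iff_nat (pairRad e)]
  simpa only [add_comm _ (pairRad e)] using h

/-! #### Translation invariance -/

/-- The wired density of `e + v` in `Λ_N` is the wired density of `e` in the translated box
`Λ_N - v`. [cite: Grimmett2006, §4.3 (automorphism invariance)] -/
theorem boxWiredEdgeProb_map_add_eq (v : Site d) {p q : ℝ} (hp : p ∈ Set.Icc (0 : ℝ) 1) (hq : 0 < q)
    (e : Sym2 (Site d)) (N : ℕ) :
    boxWiredEdgeProb d p q (e.map (· + v)) N =
      wiredEdgeProb (Finset.Icc (fun i => -(N : ℤ) + (-v) i) (fun i => (N : ℤ) + (-v) i)) p q e := by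
  rw [boxWiredEdgeProb, wiredEdgeProb_eq_of_iso (zdShiftIso (-v)) (mem_icc_shift_iff N (-v)) hp hq, Sym2.map_map]
  have hid : (⇑(zdShiftIso (-v)) ∘ fun x : Site d => x + v) = id := by
    funext x; simp
  rw [hid, Sym2.map_id, id_eq]

/-- The free density of `e + v` in `Λ_N` is the free density of `e` in the translated box
`Λ_N - v`. [cite: Grimmett2006, §4.3 (automorphism invariance)] -/
theorem boxFreeEdgeProb_map_add_eq (v : Site d) {p q : ℝ} (hp : p ∈ Set.Icc (0 : ℝ) 1) (hq : 0 < q)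
    (e : Sym2 (Site d)) (N : ℕ) :
    boxFreeEdgeProb d p q (e.map (· + v)) N =
      freeEdgeProb (Finset.Icc (fun i => -(N : ℤ) + (-v) i) (fun i => (N : ℤ) + (-v) i)) p q e := by
  rw [boxFreeEdgeProb, freeEdgeProb_eq_of_iso (zdShiftIso (-v)) (mem_icc_shift_iff N (-v)) hp hq, Sym2.map_map]
  have hid : (⇑(zdShiftIso (-v)) ∘ fun x : Site d => x + v) = id := by
    funext x; simp
  rw [hid, Sym2.map_id, id_eq]

/-- A point of `e` lies in the translated box `Λ_N - v` as soon as `e + v ⊆ Λ_N`. [folklore] -/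
theorem mem_icc_neg_shift_of_pairRad_map_add_le {v : Site d} {e : Sym2 (Site d)} {N : ℕ}
    (hN : pairRad (e.map (· + v)) ≤ N) :
    ∀ z ∈ e, z ∈ Finset.Icc (fun i => -(N : ℤ) + (-v) i) (fun i => (N : ℤ) + (-v) i) := by
  intro z hz
  have hzv : z + v ∈ box d N :=
    mem_box_of_pairRad_le hN (z + v) (Sym2.mem_map.2 ⟨z, hz, rfl⟩)
  rw [mem_box] at hzv
  rw [mem_siteIcc_iff]
  intro i
  have := hzv i
  rw [Pi.add_apply] at this
  rw [Pi.neg_apply]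
  omega

/-- Sandwich, lower side: `φ¹_{Λ_{N+‖v‖}}(e open) ≤ φ¹_{Λ_N}((e + v) open)` once `e + v ⊆ Λ_N`.
[cite: Grimmett2006, Thm. (4.19)(a), proof, eq. (4.24)] -/
theorem boxWiredEdgeProb_add_siteRad_le_map_add (hd : 0 < d) (v : Site d) {p q : ℝ} (hp : p ∈ Set.Icc (0 : ℝ) 1)
    (hq : 1 ≤ q) {e : Sym2 (Site d)} {N : ℕ} (hN : pairRad (e.map (· + v)) ≤ N) :
    boxWiredEdgeProb d p q e (N + siteRad v) ≤ boxWiredEdgeProb d p q (e.map (· + v)) N := by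
  have hq0 : 0 < q := one_pos.trans_le hq
  rw [boxWiredEdgeProb_map_add_eq v hp hq0, boxWiredEdgeProb, box_eq_Icc']
  have hsub := icc_shift_subset_box_add (d := d) N (-v)
  rw [siteRad_neg, box_eq_Icc'] at hsub
  exact wiredEdgeProb_icc_anti hd (fun i => by simp) hsub hp hq (mem_icc_neg_shift_of_pairRad_map_add_le hN)

/-- Sandwich, upper side: `φ¹_{Λ_N}((e + v) open) ≤ φ¹_{Λ_{N-‖v‖}}(e open)` once `e ⊆ Λ_{N-‖v‖}`.
[cite: Grimmett2006, Thm. (4.19)(a), proof, eq. (4.24)] -/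
theorem boxWiredEdgeProb_map_add_le_sub_siteRad (hd : 0 < d) (v : Site d) {p q : ℝ}
    (hp : p ∈ Set.Icc (0 : ℝ) 1) (hq : 1 ≤ q) {e : Sym2 (Site d)} {N : ℕ} (hN : pairRad e + siteRad v ≤ N) :
    boxWiredEdgeProb d p q (e.map (· + v)) N ≤ boxWiredEdgeProb d p q e (N - siteRad v) := by
  have hq0 : 0 < q := one_pos.trans_le hq
  rw [boxWiredEdgeProb_map_add_eq v hp hq0, boxWiredEdgeProb, box_eq_Icc']
  have hsub := box_sub_subset_icc_shift (d := d) (n := N) (v := -v) (by rw [siteRad_neg]; omega)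
  rw [siteRad_neg, box_eq_Icc'] at hsub
  refine wiredEdgeProb_icc_anti hd (fun i => by simp) hsub hp hq ?_
  rw [← box_eq_Icc']
  exact mem_box_of_pairRad_le (by omega)

/-- **Translation invariance of the limiting wired density**: `h¹(e + v) = h¹(e)`.
[cite: Grimmett2006, (4.61) ("h^b(p,q) does not depend on the choice of e")] -/
theorem wiredEdgeDensity_map_add (hd : 0 < d) (v : Site d) {p q : ℝ} (hp : p ∈ Set.Icc (0 : ℝ) 1) (hq : 1 ≤ q)
    (e : Sym2 (Site d)) : wiredEdgeDensity d p q (e.map (· + v)) = wiredEdgeDensity d p q e := by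
  -- squeeze `boxWiredEdgeProb (e+v) N` between two shifted copies of `boxWiredEdgeProb e`, both tending to `wiredEdgeDensity e`
  have hlim := tendsto_boxWiredEdgeProb hd hp hq e
  have hlim' := tendsto_boxWiredEdgeProb hd hp hq (e.map (· + v))
  have hup : Tendsto (fun N => boxWiredEdgeProb d p q e (N - siteRad v)) atTop (𝓝 (wiredEdgeDensity d p q e)) :=
    hlim.comp (tendsto_sub_atTop_nat (siteRad v))
  have hlo : Tendsto (fun N => boxWiredEdgeProb d p q e (N + siteRad v)) atTop (𝓝 (wiredEdgeDensity d p q e)) :=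
    hlim.comp (tendsto_add_atTop_nat (siteRad v))
  refine tendsto_nhds_unique hlim' (tendsto_of_tendsto_of_tendsto_of_le_of_le' hlo hup ?_ ?_)
  · filter_upwards [eventually_ge_atTop (pairRad (e.map (· + v)))] with N hN
    exact boxWiredEdgeProb_add_siteRad_le_map_add hd v hp hq hN
  · filter_upwards [eventually_ge_atTop (pairRad e + siteRad v)] with N hN
    exact boxWiredEdgeProb_map_add_le_sub_siteRad hd v hp hq hN

/-- Sandwich for the free densities, lower side: `φ⁰_{Λ_{N-‖v‖}}(e open) ≤ φ⁰_{Λ_N}((e+v) open)`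
once `e ⊆ Λ_{N-‖v‖}`. [cite: Grimmett2006, Thm. (4.19)(a), proof, eq. (4.24)] -/
theorem boxFreeEdgeProb_sub_siteRad_le_map_add (v : Site d) {p q : ℝ} (hp : p ∈ Set.Icc (0 : ℝ) 1)
    (hq : 1 ≤ q) {e : Sym2 (Site d)} {N : ℕ} (hN : pairRad e + siteRad v ≤ N) :
    boxFreeEdgeProb d p q e (N - siteRad v) ≤ boxFreeEdgeProb d p q (e.map (· + v)) N := by
  have hq0 : 0 < q := one_pos.trans_le hq
  rw [boxFreeEdgeProb_map_add_eq v hp hq0, boxFreeEdgeProb]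
  have hsub := box_sub_subset_icc_shift (d := d) (n := N) (v := -v) (by rw [siteRad_neg]; omega)
  rw [siteRad_neg] at hsub
  exact freeEdgeProb_mono hsub hp hq (mem_box_of_pairRad_le (by omega))

/-- Sandwich for the free densities, upper side: `φ⁰_{Λ_N}((e+v) open) ≤ φ⁰_{Λ_{N+‖v‖}}(e open)`
once `e + v ⊆ Λ_N`. [cite: Grimmett2006, Thm. (4.19)(a), proof, eq. (4.24)] -/
theorem boxFreeEdgeProb_map_add_le_add_siteRad (v : Site d) {p q : ℝ} (hp : p ∈ Set.Icc (0 : ℝ) 1)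
    (hq : 1 ≤ q) {e : Sym2 (Site d)} {N : ℕ} (hN : pairRad (e.map (· + v)) ≤ N) :
    boxFreeEdgeProb d p q (e.map (· + v)) N ≤ boxFreeEdgeProb d p q e (N + siteRad v) := by
  have hq0 : 0 < q := one_pos.trans_le hq
  rw [boxFreeEdgeProb_map_add_eq v hp hq0, boxFreeEdgeProb]
  have hsub := icc_shift_subset_box_add (d := d) N (-v)
  rw [siteRad_neg] at hsub
  exact freeEdgeProb_mono hsub hp hq (mem_icc_neg_shift_of_pairRad_map_add_le hN)

/-- **Translation invariance of the limiting free density**: `h⁰(e + v) = h⁰(e)`.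
[cite: Grimmett2006, (4.61) ("h^b(p,q) does not depend on the choice of e")] -/
theorem freeEdgeDensity_map_add (v : Site d) {p q : ℝ} (hp : p ∈ Set.Icc (0 : ℝ) 1) (hq : 1 ≤ q)
    (e : Sym2 (Site d)) : freeEdgeDensity d p q (e.map (· + v)) = freeEdgeDensity d p q e := by
  have hlim := tendsto_boxFreeEdgeProb hp hq e
  have hlim' := tendsto_boxFreeEdgeProb hp hq (e.map (· + v))
  have hlo : Tendsto (fun N => boxFreeEdgeProb d p q e (N - siteRad v)) atTop (𝓝 (freeEdgeDensity d p q e)) :=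
    hlim.comp (tendsto_sub_atTop_nat (siteRad v))
  have hup : Tendsto (fun N => boxFreeEdgeProb d p q e (N + siteRad v)) atTop (𝓝 (freeEdgeDensity d p q e)) :=
    hlim.comp (tendsto_add_atTop_nat (siteRad v))
  refine tendsto_nhds_unique hlim' (tendsto_of_tendsto_of_tendsto_of_le_of_le' hlo hup ?_ ?_)
  · filter_upwards [eventually_ge_atTop (pairRad e + siteRad v)] with N hN
    exact boxFreeEdgeProb_sub_siteRad_le_map_add v hp hq hN
  · filter_upwards [eventually_ge_atTop (pairRad (e.map (· + v)))] with N hN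
    exact boxFreeEdgeProb_map_add_le_add_siteRad v hp hq hN

/-! #### Invariance under the symmetries of the box -/

/-- Membership test for `finsetGraphIso` of a signed coordinate permutation acting on `Λ_N`
(which it preserves). [folklore] -/
theorem mem_box_iff_signedPerm_symm_mem (π : Equiv.Perm (Fin d)) (ε : Fin d → ℤˣ) (N : ℕ)
    (x : Site d) : x ∈ box d N ↔ (zdSignedPermIso π ε).symm x ∈ box d N := by
  rw [show (zdSignedPermIso π ε).symm x = (Site.signedPerm π ε).symm x from rfl, Site.signedPerm_symm,
    signedPerm_mem_box_iff]

/-- The wired box densities are invariant under signed coordinate permutations.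
[cite: Grimmett2006, §4.3 (automorphism invariance)] -/
theorem boxWiredEdgeProb_map_signedPerm (π : Equiv.Perm (Fin d)) (ε : Fin d → ℤˣ) {p q : ℝ}
    (hp : p ∈ Set.Icc (0 : ℝ) 1) (hq : 0 < q) (e : Sym2 (Site d)) (N : ℕ) :
    boxWiredEdgeProb d p q (e.map (zdSignedPermIso π ε)) N = boxWiredEdgeProb d p q e N :=
  (wiredEdgeProb_eq_of_iso (zdSignedPermIso π ε) (mem_box_iff_signedPerm_symm_mem π ε N) hp hq e).symm

/-- The free box densities are invariant under signed coordinate permutations.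
[cite: Grimmett2006, §4.3 (automorphism invariance)] -/
theorem boxFreeEdgeProb_map_signedPerm (π : Equiv.Perm (Fin d)) (ε : Fin d → ℤˣ) {p q : ℝ}
    (hp : p ∈ Set.Icc (0 : ℝ) 1) (hq : 0 < q) (e : Sym2 (Site d)) (N : ℕ) :
    boxFreeEdgeProb d p q (e.map (zdSignedPermIso π ε)) N = boxFreeEdgeProb d p q e N :=
  (freeEdgeProb_eq_of_iso (zdSignedPermIso π ε) (mem_box_iff_signedPerm_symm_mem π ε N) hp hq e).symm

/-- **`h¹` is invariant under signed coordinate permutations.**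
[cite: Grimmett2006, (4.61) ("h^b(p,q) does not depend on the choice of e")] -/
theorem wiredEdgeDensity_map_signedPerm (hd : 0 < d) (π : Equiv.Perm (Fin d)) (ε : Fin d → ℤˣ) {p q : ℝ}
    (hp : p ∈ Set.Icc (0 : ℝ) 1) (hq : 1 ≤ q) (e : Sym2 (Site d)) :
    wiredEdgeDensity d p q (e.map (zdSignedPermIso π ε)) = wiredEdgeDensity d p q e := by
  have hq0 : 0 < q := one_pos.trans_le hq
  refine tendsto_nhds_unique (tendsto_boxWiredEdgeProb hd hp hq _) ?_
  simp only [boxWiredEdgeProb_map_signedPerm π ε hp hq0]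
  exact tendsto_boxWiredEdgeProb hd hp hq e

/-- **`h⁰` is invariant under signed coordinate permutations.**
[cite: Grimmett2006, (4.61) ("h^b(p,q) does not depend on the choice of e")] -/
theorem freeEdgeDensity_map_signedPerm (π : Equiv.Perm (Fin d)) (ε : Fin d → ℤˣ) {p q : ℝ}
    (hp : p ∈ Set.Icc (0 : ℝ) 1) (hq : 1 ≤ q) (e : Sym2 (Site d)) :
    freeEdgeDensity d p q (e.map (zdSignedPermIso π ε)) = freeEdgeDensity d p q e := by
  have hq0 : 0 < q := one_pos.trans_le hq
  refine tendsto_nhds_unique (tendsto_boxFreeEdgeProb hp hq _) ?_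
  simp only [boxFreeEdgeProb_map_signedPerm π ε hp hq0]
  exact tendsto_boxFreeEdgeProb hp hq e

/-! #### All edges of `ℤ^d` have the same limiting densities -/

/-- Every edge of `ℤ^d` is a translate of a coordinate edge `⟨0, eᵢ⟩` at the origin.
[folklore] -/
theorem exists_eq_map_add_of_mem_edgeSet {e : Sym2 (Site d)} (he : e ∈ (zdGraph d).edgeSet) :
    ∃ (i : Fin d) (x : Site d), e = Sym2.map (· + x) s(0, Pi.single i 1) := by
  induction e using Sym2.ind with
  | h a b =>
    rw [mem_edgeSet] at he
    obtain ⟨i, h | h⟩ := (zdGraph_adj_iff _ _).1 he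
    · refine ⟨i, a, ?_⟩
      rw [Sym2.map_mk, zero_add, add_comm, ← h]
    · refine ⟨i, b, ?_⟩
      rw [Sym2.map_mk, zero_add, add_comm, ← h, Sym2.eq_swap]

/-- The transposition of coordinates `i, j` (a signed permutation with trivial signs) maps the
coordinate edge `⟨0, eᵢ⟩` to `⟨0, eⱼ⟩`. [folklore] -/
theorem map_swap_coordEdge (i j : Fin d) :
    Sym2.map (zdSignedPermIso (Equiv.swap i j) 1) s((0 : Site d), Pi.single i 1) = s(0, Pi.single j 1) := by
  rw [Sym2.map_mk]
  congr 1
  funext k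
  simp only [zdSignedPermIso_apply, Site.signedPerm_apply, Pi.one_apply, Units.val_one, one_mul,
    Equiv.symm_swap]
  rcases eq_or_ne k j with rfl | hkj
  · simp
  · rw [Pi.single_eq_of_ne hkj]
    rcases eq_or_ne k i with rfl | hki
    · rw [Equiv.swap_apply_left, Pi.single_eq_of_ne hkj.symm]
    · rw [Equiv.swap_apply_of_ne_of_ne hki hkj, Pi.single_eq_of_ne hki]

/-- **The limiting wired density is the same for all edges of `ℤ^d`** (Grimmett 2006, (4.61)).
[cite: Grimmett2006, (4.61) ("h^b(p,q) does not depend on the choice of e")] -/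
theorem wiredEdgeDensity_eq_of_mem_edgeSet (hd : 0 < d) {p q : ℝ} (hp : p ∈ Set.Icc (0 : ℝ) 1) (hq : 1 ≤ q)
    {e e' : Sym2 (Site d)} (he : e ∈ (zdGraph d).edgeSet) (he' : e' ∈ (zdGraph d).edgeSet) :
    wiredEdgeDensity d p q e = wiredEdgeDensity d p q e' := by
  obtain ⟨i, x, rfl⟩ := exists_eq_map_add_of_mem_edgeSet he
  obtain ⟨j, y, rfl⟩ := exists_eq_map_add_of_mem_edgeSet he'
  rw [wiredEdgeDensity_map_add hd x hp hq, wiredEdgeDensity_map_add hd y hp hq, ← map_swap_coordEdge i j,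
    wiredEdgeDensity_map_signedPerm hd _ _ hp hq]

/-- **The limiting free density is the same for all edges of `ℤ^d`** (Grimmett 2006, (4.61)).
[cite: Grimmett2006, (4.61) ("h^b(p,q) does not depend on the choice of e")] -/
theorem freeEdgeDensity_eq_of_mem_edgeSet {p q : ℝ} (hp : p ∈ Set.Icc (0 : ℝ) 1) (hq : 1 ≤ q)
    {e e' : Sym2 (Site d)} (he : e ∈ (zdGraph d).edgeSet) (he' : e' ∈ (zdGraph d).edgeSet) :
    freeEdgeDensity d p q e = freeEdgeDensity d p q e' := by
  obtain ⟨i, x, rfl⟩ := exists_eq_map_add_of_mem_edgeSet he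
  obtain ⟨j, y, rfl⟩ := exists_eq_map_add_of_mem_edgeSet he'
  rw [freeEdgeDensity_map_add x hp hq, freeEdgeDensity_map_add y hp hq, ← map_swap_coordEdge i j, freeEdgeDensity_map_signedPerm _ _ hp hq]

end Densities

end Literature.Probability.LatticeModels

end
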